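import Summits.QuantumFields.YangMills.Theorems.BalabanUVNodesN22W1CouplingRadiiPhaseTower
import Summits.QuantumFields.YangMills.Theorems.BalabanUVNodesN22W1CouplingRadiiPhaseTowerVertex

/-!
# BalabanUVNodes ∕ node N22 = NE9 — THE S-SIDE OF THE RECORD EDITIONS AT THE PHASE TOWERS, ALL TORI AT ONCE: the tower-side antecedents of dag-n22-w5's
# record files (`…N22AtRecordOfCouplingHoloSlots` p610260, `…OfPrintedSlots` p608801, `…OfPrintedSlotsClosed` p611990) inhabited NON-degenerately, by name

Cell `pub-ymgap`, HUMAN RULING D-0062 (Track A) ∕ D-0149, WIDTH SEAT `pub-ymgap-dag-n22-w1` (harness re-seat g3) on node n22 = NE9; `--kind proof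
--supports stmt-QuantumFields-20544 --as helper` (K3⁷ `SpineGivenEndpointR13SepCoPH`), COUNT-NEUTRAL.  THEOREMS ONLY (0 `def`, 0 `sorry`, standard axioms); the piece
«(record′)» handed to this seat by dag-n22-w5 g0 (pub-ymgap INBOX, 2026-08-28 «w1 take (record′) — GO»).  Imports this seat's `…PhaseTower` (p611030) and `…PhaseTowerVertex`
(p612869) ONLY — no file of dag-n22-w5's is imported or touched; their binders are copied VERBATIM as conclusions.

WHY.  dag-n22-w5's record editions carry node N22's K3⁷-facing faces (`h9` ∕ `hdec` ∕ the pin faces at `rateCarriersOfRecord₁₃CoPH`) from DISPLAYED inputs; the inputs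
that concern the cluster towers `S : (K : ℕ) → ClusterTower (F.P K) (MatA N) M` («the S-side») are, per edition: p610260 `…_of_coordHolo_analyticH` — the margin datum `hH`
(radius table `ρt`, amplitude `A`, box `]0, θ.γ]`) and the PRINTED `AnalyticH` slot `hAn`; p610260 `…_of_coordHoloVertex_analyticH` — `hOld` ∕ `hLast` (amplitudes `A`, `A′`,
slope `c`) and `hAn`; p608801 ∕ p611990 — W1's `Bound238` (`h238`), `YoungLipschitz` with a table `fun i => Λ (k+1) i` (`hYL`) and `hAn`.  Their only S-side rider is the
TERMLESS step (`analyticH_termlessStep`).  THIS MODULE packages, for EVERY family `F`, cube count `M`, normed configuration algebra `𝔸` (e.g. `MatA N`), box height `γ`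
and letters, a family of PHASE TOWERS over ALL tori `K` (one term per polymer, activities of modulus `A e^{−2} e^{−R d(Z)}` reading every coupling) at which ALL these
S-side binders hold simultaneously and for EVERY space-table family `sp` — `ρt n i := ϱ·(ω^{n−i})⁻¹`, `Λ n i := 4A∕(ϱ·(ω^{n−i})⁻¹)` (genuinely geometric), and at the
vertex `A′ := A e^{−2}(1+c)∕γ` — so each record edition's S-side antecedent is inhabited NON-degenerately by name (instantiate `S`, `ρt`, `Λ` with the witnesses here).

WHAT (all [folklore]; by-name packaging of `…PhaseTower` ∕ `…PhaseTowerVertex` over `K`).  `geomRadii_pos` ∕ `cauchyTable_nonneg` (the side conditions `hρt` ∕ `hΛ`);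
★ `exists_towers_recordSSide_phase` (box towers: `hH` + `hAn` + `h238` + `hYL`, all `sp`); ★ `exists_towers_recordSSide_phaseVertex` (vertex towers: `hOld` + `hLast` +
`hAn`, all `sp`; activities injective in the last coupling).

HONEST FRAMING.  MODEL towers, NOT NODE 00's objects.  The record editions' OTHER inputs — W1-20's law `hloc : Localizes17OfRecord₁₃ θ S emb` (NODE A's theorem about
the towers OF RECORD; NOT expected to hold for a model tower and NOT claimed here), `hlim : PolLimitsExistOfRecord₁₃`, the complexified readings `Φ` with their chart ∕
space clauses, the site weights and tails, the numerals, `θ` — stay LOCATED with their owners; a model-level inhabitant books NO discharge.  Count-neutral A6 helper; N22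
NOT discharged (typed 28∕28 · discharged 5∕27 UNCHANGED — the chair's single count line is the only count); K3⁷ OPEN, NOT claimed; NE9 ∕ `FadingMemory` NOT IN PRINT for
d = 4; one finite four-torus programme at fixed ε — R4 closes the CONDITIONAL rung `BalabanLadder.UV` only; NOT infinite volume ∕ OS on ℝ⁴ ∕ mass gap ∕ Clay.
References (TYPES only): [I] = [Balaban1987RG1] CMP **109** (1987) §1 p. 263; [II] = [Balaban1988RG2Cluster] CMP **116** (1988) (2.13)–(2.14) pp. 14–15, (2.38) p. 20.
-/

noncomputable section

namespace YMDAG.N22.W1.CouplingRadii.PhaseTower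

open Set Metric
open scoped BigOperators
open Literature.MathematicalPhysics.QuantumFieldTheory.Balaban1983to89
open Literature.MathematicalPhysics.QuantumFieldTheory.Balaban1983to89.T4Continuum (T4Family)
open Literature.MathematicalPhysics.QuantumFieldTheory.Balaban1983to89.Node00
open Literature.MathematicalPhysics.QuantumFieldTheory.Balaban1983to89.Node00.Sect2 (domSys domCount CPair)
open Literature.MathematicalPhysics.QuantumFieldTheory.Balaban1983to89.Node00.W1
open YMDAG.N22.W1.CouplingRadii.PhaseTowerVertex (exists_phaseTowerVertex norm_H_phaseStepVertex H_update_last_injective_phaseStepVertex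
  coordHoloOld_phaseStepVertex coordHoloLast_phaseStepVertex analyticH_and_localizedH_phaseStepVertex)

/-- The geometric radius table `ρt n i := ϱ·(ω^{n−i})⁻¹` is positive (the side condition `hρt` of p610260). [folklore] -/
theorem geomRadii_pos {ϱ ω : ℝ} (hϱ : 0 < ϱ) (hω : 0 < ω) (n i : ℕ) : 0 < ϱ * (ω ^ (n - i))⁻¹ :=
  mul_pos hϱ (inv_pos.2 (pow_pos hω _))

/-- The Cauchy table `Λ n i := 4A∕(ϱ·(ω^{n−i})⁻¹)` is non-negative (the side condition `hΛ` of p608801 ∕ p611990; `A ≥ 0`). [folklore] -/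
theorem cauchyTable_nonneg {A ϱ ω : ℝ} (hA : 0 ≤ A) (hϱ : 0 < ϱ) (hω : 0 < ω) (n i : ℕ) : 0 ≤ 4 * A / (ϱ * (ω ^ (n - i))⁻¹) :=
  div_nonneg (by positivity) (geomRadii_pos hϱ hω n i).le

section RecordSide
variable (F : T4Family) (𝔸 : Type*) [NormedRing 𝔸] [NormedAlgebra ℂ 𝔸] (M : ℕ)

/-- **★ THE S-SIDE OF THE RECORD EDITIONS AT THE PHASE TOWERS (box edition), ALL TORI AT ONCE.**  For every family `F`, normed configuration algebra `𝔸`, cube count `M`,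
box height `γ`, letters `A > 0`, `R`, `ϱ > 0`, `ω > 0`: THERE IS a family of cluster towers `S K` over all tori with (i) ONE multi-index per polymer, (ii) activities of
EXACT modulus `A e^{−2} e^{−R d_{k+1}(Z)}` (never termless), and, for EVERY space-table family `sp`, (iii) dag-n22-w5's margin binder `hH` of
`…_of_coordHolo_analyticH` VERBATIM at `ρt n i := ϱ·(ω^{n−i})⁻¹` (amplitude `A`, box `]0, γ]`), (iv) the PRINTED slot `hAn : AnalyticH (box γ k) (sp K k)`, (v) `h238 :
Bound238 (box γ k) (sp K k) A R`, (vi) `hYL : YoungLipschitz (box γ k) (sp K k) (fun i => Λ (k+1) i) R` at `Λ n i := 4A∕(ϱ·(ω^{n−i})⁻¹)` — `…PhaseTower`'s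
`exists_phaseTower` ∕ `norm_H_phaseStep` ∕ `coordHolo_phaseStep` ∕ `analyticH_phaseStep` ∕ `bound238_phaseStep` ∕ `youngLipschitz_phaseStep` chosen over `K`.  MODEL towers;
the record's law `Localizes17OfRecord₁₃`, `PolLimitsExistOfRecord₁₃`, readings and tails are NOT claimed for them.
[cite: Balaban1987RG1, §1 p.263; Balaban1988RG2Cluster, (2.13)-(2.14) pp.14-15 and Lemma 3 (2.38) p.20] -/
theorem exists_towers_recordSSide_phase {A R ϱ ω : ℝ} (γ : ℝ) (hA : 0 < A) (hϱ : 0 < ϱ) (hω : 0 < ω) :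
    ∃ S : (K : ℕ) → ClusterTower (F.P K) 𝔸 M,
      (∀ (K k : ℕ) (Z : (domSys (F.P K) M (k + 1)).Dom), (((S K) k).idx Z).card = 1) ∧
      (∀ (K k : ℕ) (g : Fin (k + 1) → ℝ) (φ : CPair (F.P K) 𝔸) (Z : (domSys (F.P K) M (k + 1)).Dom),
        ‖((S K) k).H g φ Z‖ = A * Real.exp (-2) * Real.exp (-(R * (domSys (F.P K) M (k + 1)).dj Z))) ∧
      ∀ sp : (K k : ℕ) → (domSys (F.P K) M (k + 1)).Dom → Set (CPair (F.P K) 𝔸),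
        (∀ (K k : ℕ), ∀ hist ∈ box γ k, ∀ (Z : (domSys (F.P K) M (k + 1)).Dom), ∀ φ ∈ sp K k Z, ∀ i : Fin (k + 1),
          ∃ (Hc : ℂ → ℂ) (O : Set ℂ), DifferentiableOn ℂ Hc O ∧
            (∀ t ∈ Ioc (0 : ℝ) γ, closedBall (t : ℂ) (ϱ * (ω ^ (k + 1 - (i : ℕ)))⁻¹) ⊆ O) ∧
            (∀ z ∈ O, ‖Hc z‖ ≤ A * Real.exp (-(R * (domSys (F.P K) M (k + 1)).dj Z))) ∧
            (∀ t ∈ Ioc (0 : ℝ) γ, Hc t = ((S K) k).H (Function.update hist i t) φ Z)) ∧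
        (∀ K k, ((S K) k).AnalyticH (box γ k) (sp K k)) ∧
        (∀ K k, ((S K) k).Bound238 (box γ k) (sp K k) A R) ∧
        (∀ K k, ((S K) k).YoungLipschitz (box γ k) (sp K k) (fun i : Fin (k + 1) => 4 * A / (ϱ * (ω ^ (k + 1 - (i : ℕ)))⁻¹)) R) := by
  choose S hcard hS using fun K => exists_phaseTower (F.P K) 𝔸 M A R ϱ ω
  refine ⟨S, hcard, fun K k => norm_H_phaseStep ((S K) k) (hS K k) hA.le, fun sp => ⟨?_, ?_, ?_, ?_⟩⟩
  · exact fun K k => coordHolo_phaseStep ((S K) k) (hS K k) hA.le hϱ hω γ (sp K k)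
  · exact fun K k => analyticH_phaseStep ((S K) k) (hS K k) (box γ k) (sp K k)
  · exact fun K k => bound238_phaseStep ((S K) k) (hS K k) hA.le hϱ hω γ (sp K k)
  · exact fun K k => youngLipschitz_phaseStep ((S K) k) (hS K k) hA.le hϱ hω γ (sp K k)

/-- **★ THE S-SIDE OF THE VERTEX RECORD EDITION AT THE VERTEX PHASE TOWERS, ALL TORI AT ONCE.**  For every `F`, normed `𝔸`, `M`, box height `γ > 0`, letters `A > 0`, `R`,
`ϱ > 0`, `ω > 0` and ANY slope `c`: THERE IS a family of cluster towers `S K` over all tori with (i) ONE multi-index per polymer, (ii) activities of modulus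
`A e^{−2} e^{−R d(Z)}·|g_k|∕γ` (nonzero on the box), (iii) INJECTIVE in the last coupling, and, for EVERY space-table family `sp`, dag-n22-w5's vertex binders VERBATIM:
(iv) `hOld` at `ρt n i := ϱ·(ω^{n−i})⁻¹` (amplitude `A`, older coordinates `i < k`), (v) `hLast` on the relative discs `D̄(s, c·s)` with `A′ := A e^{−2}(1+c)∕γ` (NO uniform
last-coupling margin), (vi) `hAn : AnalyticH (box γ k) (sp K k)` — `…PhaseTowerVertex` by name, chosen over `K`.  MODEL towers; the record's law, `PolLimitsExistOfRecord₁₃`,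
readings and tails are NOT claimed for them. [cite: Balaban1987RG1, §1 p.263; Balaban1988RG2Cluster, (2.13)-(2.14) pp.14-15 and Lemma 3 (2.38) p.20] -/
theorem exists_towers_recordSSide_phaseVertex {A R ϱ ω γ : ℝ} (c : ℝ) (hA : 0 < A) (hγ : 0 < γ) (hϱ : 0 < ϱ) (hω : 0 < ω) :
    ∃ S : (K : ℕ) → ClusterTower (F.P K) 𝔸 M,
      (∀ (K k : ℕ) (Z : (domSys (F.P K) M (k + 1)).Dom), (((S K) k).idx Z).card = 1) ∧
      (∀ (K k : ℕ) (g : Fin (k + 1) → ℝ) (φ : CPair (F.P K) 𝔸) (Z : (domSys (F.P K) M (k + 1)).Dom),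
        ‖((S K) k).H g φ Z‖ = A * Real.exp (-2) * Real.exp (-(R * (domSys (F.P K) M (k + 1)).dj Z)) * (|g (Fin.last k)| / γ)) ∧
      (∀ (K k : ℕ) (g : Fin (k + 1) → ℝ) (φ : CPair (F.P K) 𝔸) (Z : (domSys (F.P K) M (k + 1)).Dom),
        Function.Injective fun t : ℝ => ((S K) k).H (Function.update g (Fin.last k) t) φ Z) ∧
      ∀ sp : (K k : ℕ) → (domSys (F.P K) M (k + 1)).Dom → Set (CPair (F.P K) 𝔸),
        (∀ (K k : ℕ), ∀ hist ∈ box γ k, ∀ (Z : (domSys (F.P K) M (k + 1)).Dom), ∀ φ ∈ sp K k Z, ∀ i : Fin (k + 1), (i : ℕ) < k →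
          ∃ (Hc : ℂ → ℂ) (O : Set ℂ), DifferentiableOn ℂ Hc O ∧
            (∀ t ∈ Ioc (0 : ℝ) γ, closedBall (t : ℂ) (ϱ * (ω ^ (k + 1 - (i : ℕ)))⁻¹) ⊆ O) ∧
            (∀ z ∈ O, ‖Hc z‖ ≤ A * Real.exp (-(R * (domSys (F.P K) M (k + 1)).dj Z))) ∧
            (∀ t ∈ Ioc (0 : ℝ) γ, Hc t = ((S K) k).H (Function.update hist i t) φ Z)) ∧
        (∀ (K k : ℕ), ∀ hist ∈ box γ k, ∀ (Z : (domSys (F.P K) M (k + 1)).Dom), ∀ φ ∈ sp K k Z,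
          ∃ (Hc : ℂ → ℂ) (O : Set ℂ), DifferentiableOn ℂ Hc O ∧ (∀ s ∈ Ioc (0 : ℝ) γ, closedBall (s : ℂ) (c * s) ⊆ O) ∧
            (∀ s ∈ Ioc (0 : ℝ) γ, ∀ z ∈ closedBall (s : ℂ) (c * s),
              ‖Hc z‖ ≤ A * Real.exp (-2) * (1 + c) / γ * s * Real.exp (-(R * (domSys (F.P K) M (k + 1)).dj Z))) ∧
            (∀ t ∈ Ioc (0 : ℝ) γ, Hc t = ((S K) k).H (Function.update hist (Fin.last k) t) φ Z)) ∧
        (∀ K k, ((S K) k).AnalyticH (box γ k) (sp K k)) := by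
  choose S hcard hS using fun K => exists_phaseTowerVertex (F.P K) 𝔸 M A R ϱ ω γ
  refine ⟨S, hcard, fun K k => norm_H_phaseStepVertex ((S K) k) (hS K k) hA.le hγ,
    fun K k g φ Z => H_update_last_injective_phaseStepVertex ((S K) k) (hS K k) hA hγ g φ Z, fun sp => ⟨?_, ?_, ?_⟩⟩
  · exact fun K k => coordHoloOld_phaseStepVertex ((S K) k) (hS K k) hA.le hγ hϱ hω (sp K k)
  · exact fun K k => coordHoloLast_phaseStepVertex ((S K) k) (hS K k) hA.le hγ c (sp K k)
  · exact fun K k => (analyticH_and_localizedH_phaseStepVertex ((S K) k) (hS K k) (box γ k) (sp K k)).1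

end RecordSide

end YMDAG.N22.W1.CouplingRadii.PhaseTower

end
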